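import Mathlib
import Literature.AlgebraicGeometry.Motives.Jacobian
import Literature.AlgebraicGeometry.Motives.SupersingularAbelianVariety
import Literature.AlgebraicGeometry.Motives.MotivatedPeriodTorsor
import Literature.AlgebraicGeometry.HodgeTheory.FermatHypersurfaceReduction
import Literature.AlgebraicGeometry.HodgeTheory.ComplexConjugationHolds
import HarnessLib

/-!
# FermatHodgeClassesLiftToCurveAndJacobianPowers

Topic `Literature/AlgebraicGeometry/HodgeTheory`. Named literature fact(s) relocated by the gate from `Summits/HodgeConjecture/HodgeConjecture/Theorems/PadicSemiregularLiftFermatAnchorAssemblyStubTransfer.lean`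
(accept-time relocation of `[cite]`d propositions written inline in a Summits proposal; human ruling 2026-08-15).
Sources: Fulton1998, Lange2023AbelianVarietiesC, Milne1986JacobianVarieties, Shioda1979HodgeFermat, ShiodaKatsura1979, Voisin2025, daSilva2021HodgeFermat.

* `Literature.AlgebraicGeometry.HodgeTheory.CurvePowerHodgeClassesLiftToJacobianPowers`
* `Literature.AlgebraicGeometry.HodgeTheory.FermatHodgeClassesLiftToCurvePowers` — **REFUTED as
  stated; deprecated and retired from the literature debt (verdict clean-up 2026-08-16).** False
  at `(m, n, p) = (3, 2, 1)` by a dimension count (`b₂` of the Fermat cubic surface is `7`, all of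
  type `(1,1)`; `dim H²` of the square of the Fermat cubic curve is `6`). Refuting theorem
  (kernel-checked, unconditional, KEPT):
  `Literature.AlgebraicGeometry.HodgeTheory.not_fermatHodgeClassesLiftToCurvePowers`
  (companion file `FermatHodgeClassesLiftToCurveAndJacobianPowersProofs.lean`, p119799), through the
  conditional form `not_fermatHodgeClassesLiftToCurvePowers_of_finrank` of the last section of
  this file, its two Betti-number hypotheses being the theorems
  `finrank_complexBetti_two_pow_two_fermatCubicCurve_le` (`PlaneCubicFirstBetti.lean`) and
  `seven_le_finrank_span_rational_one_one` (`FermatCubicSurfaceSevenLines.lean`). Corrected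
  statement (the multi-host finite-sum form of Shioda–Katsura's inductive structure, Prop. 2.4 (2.5)
  / Shioda 1979, Thm. I): the named fact
  `Literature.AlgebraicGeometry.HodgeTheory.FermatHodgeClassesLiftToCurvePowersSum`
  (`FermatHodgeClassesLiftToCurvePowersSum.lean`, which imports this file — hence not re-declared
  here). The refuted def is kept, statement byte-for-byte, under `@[deprecated]`, only because its
  refutation and the append-only Summits file
  `Summits/HodgeConjecture/HodgeConjecture/Theorems/PadicSemiregularLiftFermatAnchorAssemblyStubTransfer.lean`
  (superseded by `…StubTransferSum.lean`, which consumes the corrected fact) name it; no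
  `FermatHodgeClassesLiftToCurvePowers_holds` can exist.
-/

namespace Literature.AlgebraicGeometry.HodgeTheory

open CategoryTheory AlgebraicGeometry
open Literature.AlgebraicGeometry Literature.AlgebraicGeometry.Motives
open Literature.AlgebraicTopology.SingularHomology

/-- **Refuted as stated — deprecated and retired from the literature debt (verdict clean-up
2026-08-16); kept, statement byte-for-byte, only because its refutation and an append-only
Summits file name it.** The record was MEANT to render the Hodge-class consequence of the
inductive structure of Fermat varieties (Shioda–Katsura, *On Fermat varieties*, §1 Thm. 1.7 and
Cor. 1.11: for `r, s ≥ 1` the rational map `Xʳₘ × Xˢₘ ⇢ X^{r+s}ₘ`,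
`([x], [y]) ↦ [x₀y_{s+1} : ⋯ : x_r y_{s+1} : εx_{r+1}y₀ : ⋯ : εx_{r+1}y_s]` (`εᵐ = -1`), becomes a
morphism `ψ : Z_{r,s} → X^{r+s}ₘ` of degree `m` on the blow-up `β : Z_{r,s} → Xʳₘ × Xˢₘ` along
`X^{r-1}ₘ × X^{s-1}ₘ`, so that `Xⁿₘ` is dominated by the `n`-fold product `C_mⁿ` of the Fermat
curve `C_m = X¹ₘ`; Shioda, Math. Ann. 245 (1979), Thm. I: the correspondences of the blow-up
diagram induce an isomorphism of `ℚ`-Hodge structures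
`[Hʳ_prim(Xʳₘ) ⊗ Hˢ_prim(Xˢₘ)]^{μₘ} ⊕ [H^{r-1}_prim(X^{r-1}ₘ) ⊗ H^{s-1}_prim(X^{s-1}ₘ)](-1) ≅
H^{r+s}_prim(X^{r+s}ₘ)` preserving algebraic cycles). As elaborated it asserts, with the SINGLE
host `C_mⁿ = (fermatHypersurface 1 m).pow n` in the SAME degree: for `m ≥ 1`, `n ≥ 1` and every
`p` there is a `ℂ`-linear `F : H²ᵖ(C_mⁿ(ℂ); ℂ) → H²ᵖ(Xⁿₘ(ℂ); ℂ)` mapping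
`algebraicClasses (C_mⁿ) p` into `algebraicClasses (Xⁿₘ) p` such that every rational class of
Hodge type `(p, p)` on `Xⁿₘ` is `F a` for a rational class `a` of type `(p, p)` on `C_mⁿ`.
**What is wrong:** a dominant rational map of finite degree induces no surjection in cohomology —
the blow-up resolving it ADDS the cohomology of its centre (Shioda–Katsura, Lemma 2.1 and
Prop. 2.4 (2.5)): the Tate-twisted summand `[H^{r-1}_prim ⊗ H^{s-1}_prim](-1)` of Theorem I comes
from the CENTRE `X^{r-1}ₘ × X^{s-1}ₘ` in degree `r + s - 2` and is not a quotient of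
`H*(Xʳₘ × Xˢₘ)`. **Counterexample `(m, n, p) = (3, 2, 1)`:** the Fermat cubic surface `X²₃` has
`b₂ = 7` with all of `H²(X²₃; ℚ) ≅ ℚ⁷` rational of type `(1, 1)` (the 27 lines; Hartshorne V.4),
while `C₃` is an elliptic curve and `dim_ℂ H²((C₃ × C₃)(ℂ); ℂ) = 6` (Künneth `1 + 4 + 1`); no
linear map out of a `6`-dimensional space has seven linearly independent classes in its range.
**Refutation (kernel-checked, unconditional, kept):**
`Literature.AlgebraicGeometry.HodgeTheory.not_fermatHodgeClassesLiftToCurvePowers`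
(`FermatHodgeClassesLiftToCurveAndJacobianPowersProofs.lean`, p119799), assembled from the
conditional dimension count `not_fermatHodgeClassesLiftToCurvePowers_of_finrank` (this file, last
section) and the two Betti-number theorems `finrank_complexBetti_two_pow_two_fermatCubicCurve_le`
(`PlaneCubicFirstBetti.lean`) and `seven_le_finrank_span_rational_one_one`
(`FermatCubicSurfaceSevenLines.lean`). **Corrected statement — use instead:** the named fact
`Literature.AlgebraicGeometry.HodgeTheory.FermatHodgeClassesLiftToCurvePowersSum`
(`FermatHodgeClassesLiftToCurvePowersSum.lean`): the MULTI-HOST finite-sum form — finitely many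
hosts `C_m^{kᵢ}`, `kᵢ = n - 2j`, acting from the shifted degrees `2(p - j)`, every rational
`(p,p)`-class of `Xⁿₘ` being `Σᵢ Fᵢ aᵢ` — which is the shape of Shioda–Katsura Prop. 2.4 (2.5) /
Shioda Thm. I and the one the Summits consumer `…StubTransferSum.lean` takes. It is not
re-declared here (that file imports this one); no `FermatHodgeClassesLiftToCurvePowers_holds` can
exist.
[cite: ShiodaKatsura1979, §1 Thm. 1.7 and Cor. 1.11; §2 Lemma 2.1 and Prop. 2.4 (2.5) — what the source proves instead]
[cite: Shioda1979HodgeFermat, Thm. I (inductive structure of the cohomology, two summands)]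
[file AlgebraicGeometry/HodgeTheory/FermatHodgeClassesLiftToCurveAndJacobianPowers] -/
@[deprecated "refuted as stated (single host `C_mⁿ`, same degree — false at (m, n, p) = (3, 2, 1)): \
  see Literature.AlgebraicGeometry.HodgeTheory.not_fermatHodgeClassesLiftToCurvePowers \
  (FermatHodgeClassesLiftToCurveAndJacobianPowersProofs.lean); corrected statement: \
  Literature.AlgebraicGeometry.HodgeTheory.FermatHodgeClassesLiftToCurvePowersSum \
  (FermatHodgeClassesLiftToCurvePowersSum.lean, multi-host finite-sum form)" (since := "2026-08-16")]
def FermatHodgeClassesLiftToCurvePowers : Prop :=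
  ∀ (m n p : ℕ), 1 ≤ m → 1 ≤ n →
    ∃ F : complexBetti ((fermatHypersurface 1 m).pow n) (2 * p) →ₗ[ℂ]
        complexBetti (fermatHypersurface n m) (2 * p),
      (∀ a ∈ algebraicClasses ((fermatHypersurface 1 m).pow n) p,
          F a ∈ algebraicClasses (fermatHypersurface n m) p) ∧
      ∀ c : complexBetti (fermatHypersurface n m) (2 * p), IsRationalClass c →
        IsOfHodgeType n (fermatHypersurface n m) (2 * p) p p c →
          ∃ a : complexBetti ((fermatHypersurface 1 m).pow n) (2 * p), IsRationalClass a ∧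
            IsOfHodgeType n ((fermatHypersurface 1 m).pow n) (2 * p) p p a ∧ F a = c

-- The general form (Shioda's Thm. I as an ISOMORPHISM of Hodge structures: primitive parts,
-- `μₘ`-invariants, Tate twists, induced by the explicit correspondences `ψ_* β^*`, `ψ_* j_* π^*`)
-- and its Hodge-class consequence live with the corrected fact `FermatHodgeClassesLiftToCurvePowersSum`
-- (`FermatHodgeClassesLiftToCurvePowersSum.lean`), not with this retired record.

/-- **Hodge classes on powers of a curve come from the powers of its Jacobian (Abel–Jacobi),
modulo algebraic classes.** For a complete nonsingular curve `C/ℂ` of genus `g ≥ 1` with Jacobian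
`J` and the canonical map `α = f^P : C → J` of a point `P` (Milne, *Jacobian varieties*, §2;
Lange, *Abelian Varieties over the Complex Numbers*, §4.1.1 `J(C) = H⁰(ω_C)^∨/H₁(C, ℤ)` and proof
of Lemma 4.4.1: `α^* : H¹(J, ℤ) → H¹(C, ℤ)` is an isomorphism; Milne Thm. 2.5), the pull-back
along `αᴺ⁺¹ : Cᴺ⁺¹ → Jᴺ⁺¹` is a SURJECTIVE morphism of polarisable `ℚ`-Hodge structures
`H*(Jᴺ⁺¹, ℚ) ↠ H*(Cᴺ⁺¹, ℚ)` (Künneth; `H¹(J) ≅ H¹(C)`, and `H¹(C) ∪ H¹(C) = H²(C)` for `g ≥ 1`),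
so every Hodge class of `H²ᵖ(Cᴺ⁺¹, ℚ)` is `(αᴺ⁺¹)^* b` for a Hodge class `b` of `H²ᵖ(Jᴺ⁺¹, ℚ)`
(Voisin 2025, Cor. 2.12: Hodge classes lift along surjections from polarised Hodge structures),
while `(αᴺ⁺¹)^*` carries classes of algebraic cycles to classes of algebraic cycles (Fulton,
*Intersection Theory*, Cor. 19.2: `cl` is contravariant for morphisms of non-singular varieties).
For `g = 0` (`C ≅ ℙ¹`, `J = 0`) every class of `H*((ℙ¹)ᴺ⁺¹, ℚ)` is a combination of cross products
of point classes, i.e. algebraic (Fulton, Example 19.1.11). On the tree's real carriers, for ANY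
Jacobian `𝒥 : Motives.Jacobian C` (all are isomorphic, `Jacobian.uniqueUpToIso`),
`Jᴺ⁺¹ = (𝒥.J.powSucc N).X` and `Cᴺ⁺¹ = C.pow (N + 1)` (`Motives.SchemeOver.pow`), both genera at
once: **for `C` smooth projective of dimension `1` over `ℂ`, `𝒥` a Jacobian of `C` and all `N, p`,
there is a `ℂ`-linear `G : H²ᵖ(Jᴺ⁺¹(ℂ); ℂ) → H²ᵖ(Cᴺ⁺¹(ℂ); ℂ)` mapping
`algebraicClasses (Jᴺ⁺¹) p` into `algebraicClasses (Cᴺ⁺¹) p` such that for every rational class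
`a` of Hodge type `(p, p)` on `Cᴺ⁺¹` there is a rational class `b` of Hodge type `(p, p)` on `Jᴺ⁺¹`
with `a - G b ∈ algebraicClasses (Cᴺ⁺¹) p`** (`G = (αᴺ⁺¹)^* ⊗ ℂ` and `a = G b` for `g ≥ 1`; `G = 0`
for `g = 0`).
[cite: Lange2023AbelianVarietiesC, §4.1.1 and Lemma 4.4.1 (proof)]
[cite: Milne1986JacobianVarieties, §2 Prop. 2.1 and Thm. 2.5] [cite: Voisin2025, Prop. 2.11 and Cor. 2.12]
[cite: Fulton1998, §19.2 Cor. 19.2 and Example 19.1.11]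
[file AlgebraicGeometry/HodgeTheory/FermatHodgeClassesLiftToCurveAndJacobianPowers] -/
def CurvePowerHodgeClassesLiftToJacobianPowers : Prop :=
  ∀ (C : SchemeOver ℂ), IsSmoothProjective 1 C → ∀ (𝒥 : Jacobian C) (N p : ℕ),
    ∃ G : complexBetti (𝒥.J.powSucc N).X (2 * p) →ₗ[ℂ] complexBetti (C.pow (N + 1)) (2 * p),
      (∀ b ∈ algebraicClasses (𝒥.J.powSucc N).X p, G b ∈ algebraicClasses (C.pow (N + 1)) p) ∧
      ∀ a : complexBetti (C.pow (N + 1)) (2 * p), IsRationalClass a →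
        IsOfHodgeType (N + 1) (C.pow (N + 1)) (2 * p) p p a →
          ∃ b : complexBetti (𝒥.J.powSucc N).X (2 * p), IsRationalClass b ∧
            IsOfHodgeType (𝒥.J.powSucc N).dim (𝒥.J.powSucc N).X (2 * p) p p b ∧
            a - G b ∈ algebraicClasses (C.pow (N + 1)) p

-- TODO(general form): for `g ≥ 1` the printed statement is the surjectivity of the morphism of
-- Hodge structures `(αᴺ⁺¹)^*` itself (with `a = G b` exactly); the tree has algebraicity of
-- pull-backs only for flat maps (`map_mem_algebraicClasses_of_flat`), whence the `∃ G` form.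

/-! ## `FermatHodgeClassesLiftToCurvePowers` is refuted: the dimension count, formally

`FermatHodgeClassesLiftToCurvePowers` above (deprecated, retired from the debt) is **false as
written**: it claims a single
`ℂ`-linear `F : H²ᵖ(C_mⁿ(ℂ); ℂ) → H²ᵖ(Xⁿₘ(ℂ); ℂ)` through which EVERY rational `(p,p)`-class of
`Xⁿₘ` lifts. At `(m, n, p) = (3, 2, 1)`: `X²₃` is the Fermat cubic surface, `b₂(X²₃) = 7` and
`h^{2,0} = 0`, so `H²(X²₃(ℂ); ℂ) ≅ ℂ⁷` is spanned by rational `(1,1)`-classes (Lefschetz; the 27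
lines span `NS(X²₃) ≅ ℤ⁷`, Hartshorne V.4), whereas `C₃` is an elliptic curve and
`H²((C₃ × C₃)(ℂ); ℂ) ≅ ℂ⁶` (Künneth, `1 + 4 + 1`); no linear map out of `ℂ⁶` has seven linearly
independent classes in its image (`not_fermatHodgeClassesLiftToCurvePowers_of_finrank` below
checks this inference, the two Betti-number facts entering as hypotheses). The slip is in the
sentence "blow-up formula, `ψ_*ψ^* = m`, Künneth ⇒ correspondence-induced surjection
`H²ᵖ(C_mⁿ, ℚ) ↠ H²ᵖ(Xⁿₘ, ℚ)`": a dominant rational map of finite degree (Shioda–Katsura,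
Cor. 1.11: `X¹ₘ × ⋯ × X¹ₘ ⇢ Xʳₘ`) induces NO surjection in cohomology — the blow-up resolving it
ADDS the cohomology of the centre (ibid., Lemma 2.1: `Hⁱ(Z) ≅ Hⁱ(X) ⊕ Σ_{j=1}^{d-1} H^{i-2j}(Y)(j)`),
and the printed cohomological identity is Shioda–Katsura, Prop. 2.4 (2.5):
`H^{r+s}(X^{r+s}ₘ) ⊕ Σ_{j=1}^{r} H^{r+s-2j}(X^{s-1}ₘ)(j) ⊕ Σ_{k=1}^{s} H^{r+s-2k}(X^{r-1}ₘ)(k)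
 ≅ H^{r+s}(Xʳₘ × Xˢₘ)^{μₘ} ⊕ H^{r+s-2}(X^{r-1}ₘ × X^{s-1}ₘ)(1)`,
whose last summand — the cohomology of the CENTRE `Y ≅ X^{r-1}ₘ × X^{s-1}ₘ` of the blow-up,
Tate-twisted — survives in Shioda's Theorem I as `[H^{r-1}_prim(X^{r-1}ₘ) ⊗ H^{s-1}_prim(X^{s-1}ₘ)](-1)`
and is not a quotient of `H^*(Xʳₘ × Xˢₘ)` (at `(3, 2, 1)`, Shioda–Katsura (2.12) and Remark 1.9:
`H²(X²₃) ⊕ … ≅ H²(X¹₃ × X¹₃)^{μ₃} ⊕ 9·H⁰(pt)(1)`, the nine extra classes being the blown-up points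
`X⁰₃ × X⁰₃`; primitively `6 = 2 + 4`). The CORRECT Hodge-class form of Theorem I has two hosts,
`Xʳₘ × Xˢₘ` in degree `2p` (map `ψ_*β^*`) and `X^{r-1}ₘ × X^{s-1}ₘ` in degree `2p - 2` (map
`ψ_*j_*π^*`, `j : E ↪ Z_{r,s}` the exceptional divisor, `π : E → Y`), every rational `(p,p)`-class
of `X^{r+s}ₘ` lying in `ψ_*β^*(Hodge classes) + ψ_*j_*π^*(Hodge classes) + algebraic classes` —
the shape in which Shioda–Katsura themselves use it (proof of Thm. 2.6:
`[H²(X²ₘ)(-1)]^G ⊂ [H²(X¹ₘ × X¹ₘ)(-1)]^G ⊕ (m² copies of ℚ_ℓ)`); iterated down to curve powers it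
is vendored separately as the multi-host finite-sum fact `FermatHodgeClassesLiftToCurvePowersSum`
(`FermatHodgeClassesLiftToCurvePowersSum.lean`, which imports this file), not in this relocated file.
The conditional count below is made UNCONDITIONAL downstream:
`not_fermatHodgeClassesLiftToCurvePowers` (`FermatHodgeClassesLiftToCurveAndJacobianPowersProofs.lean`)
feeds it `h₆ := finrank_complexBetti_two_pow_two_fermatCubicCurve_le` (`PlaneCubicFirstBetti.lean`)
and `h₇ := seven_le_finrank_span_rational_one_one` (`FermatCubicSurfaceSevenLines.lean`).
[cite: ShiodaKatsura1979, §1 Lemma 1.1, Thm. 1.7, Remark 1.9, Cor. 1.11; §2 Lemma 2.1, Prop. 2.4 (2.5), Cor. 2.5 (2.9), Thm. 2.6]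
[cite: Shioda1979HodgeFermat, Thm. I] [cite: daSilva2021HodgeFermat, §2 Thm. 2.2] -/

-- names the `@[deprecated]` record `FermatHodgeClassesLiftToCurvePowers` on purpose: this IS (the conditional core of)
-- its refutation (verdict clean-up 2026-08-16); REMOVE-WHEN the record is deleted from this file
set_option linter.deprecated false in
/-- **The dimension count refuting `FermatHodgeClassesLiftToCurvePowers`, formally.** If
`H²((C₃ × C₃)(ℂ); ℂ)` — on the tree's carrier `(fermatHypersurface 1 3).pow 2 = (Spec ℂ ⊗ C₃) ⊗ C₃`
— is finite-dimensional of dimension at most `6` (Künneth for the square of the Fermat cubic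
curve, an elliptic curve: `1 + 2·2 + 1`), and the rational classes of Hodge type `(1,1)` of the
Fermat cubic surface `X²₃ = fermatHypersurface 2 3` span a subspace of `H²(X²₃(ℂ); ℂ)` of dimension
at least `7` (`b₂ = 7`, `h^{2,0} = 0`: all of `H²(X²₃, ℚ) ≅ ℚ⁷` is of type `(1,1)`, Hartshorne V.4;
`H²(–, ℚ) ⊗ ℂ = H²(–, ℂ)`), then `FermatHodgeClassesLiftToCurvePowers` fails: at
`(m, n, p) = (3, 2, 1)` its second clause puts that `≥ 7`-dimensional span inside the range of a
linear map out of a `≤ 6`-dimensional space. Both hypotheses are classical Betti-number facts,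
since proved on the tree's real carriers (`finrank_complexBetti_two_pow_two_fermatCubicCurve_le`,
`seven_le_finrank_span_rational_one_one`; assembled in `not_fermatHodgeClassesLiftToCurvePowers`);
the inference is the content of this lemma.
[cite: Hartshorne1977, V.4 (Pic of the cubic surface ≅ ℤ⁷, the 27 lines)]
[cite: ShiodaKatsura1979, §1 Remark 1.9 and §2 (2.12)] -/
theorem not_fermatHodgeClassesLiftToCurvePowers_of_finrank
    [Module.Finite ℂ (complexBetti ((fermatHypersurface 1 3).pow 2) (2 * 1))]
    (h₆ : Module.finrank ℂ (complexBetti ((fermatHypersurface 1 3).pow 2) (2 * 1)) ≤ 6)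
    (h₇ : 7 ≤ Module.finrank ℂ (Submodule.span ℂ
      {c : complexBetti (fermatHypersurface 2 3) (2 * 1) |
        IsRationalClass c ∧ IsOfHodgeType 2 (fermatHypersurface 2 3) (2 * 1) 1 1 c})) :
    ¬ FermatHodgeClassesLiftToCurvePowers := by
  intro h
  obtain ⟨F, -, hF⟩ := h 3 2 1 (by norm_num) (by norm_num)
  -- every rational `(1,1)`-class of `X²₃` is in the range of `F`, hence so is their span
  have hle : Submodule.span ℂ {c : complexBetti (fermatHypersurface 2 3) (2 * 1) |
      IsRationalClass c ∧ IsOfHodgeType 2 (fermatHypersurface 2 3) (2 * 1) 1 1 c} ≤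
      LinearMap.range F := by
    refine Submodule.span_le.2 fun c hc ↦ ?_
    obtain ⟨a, -, -, ha⟩ := hF c hc.1 hc.2
    exact ⟨a, ha⟩
  have h₁ := Submodule.finrank_mono hle
  have h₂ := LinearMap.finrank_range_le F
  omega

end Literature.AlgebraicGeometry.HodgeTheory
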